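import Summits.QuantumFields.BalabanUV.Beta.EriceRemainderEnclosureHistoryAutonomyComparisonAgeCompositionDecayReduction

/-!
# EriceRemainderEnclosureHistoryAutonomyComparisonAgeCompositionDecayBudget — (E84b) route (N), first order: THE DAMPING-FREE PRODUCT INEQUALITY (★) FOR
# (S-d) FROM A LINEARISED LOGARITHMIC BUDGET — every factor below the exponential of an elementary term (the level steps credited with the logarithmic
# series truncated at the quadratic term, `−log(1−y) ≥ y + y²∕2`; the loads, the growth majorants and the last factor debited linearly), so that the
# successor's flow work is one ADDITIVE inequality between level steps and loads per pin

Cell `pub-balaban`, β-function sub-cell, BINDER row D4 «RemainderConst leaves for Bałaban's split» (`HOME/BINDER-OWNERS.md`; owner lineage `b2b-balaban-beta-an4`;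
this file by co-owner #2 lineage `b2b-balaban-beta-d4-p2`, generation 75), β-FLOW TEAM duty (1), FREEZE (0) honoured (def-free; imports (E84a)
`…DecayReduction`; uses (E48a) `strictAnti_of_memFlow`, (E82b) `load_le_of_window`, (E84a) `flow_nonneg_two_ages_of_product` and Mathlib's logarithmic
series `Real.hasSum_pow_div_log_of_abs_lt_one` BY NAME; nothing restated).  Second layer of successor item (1) of README `g74/e83` §4.

HONEST FRAMING (page 1, verbatim and binding).  *"Discharging BetaPertH makes Bałaban's UV stability UNCONDITIONAL — a real constructive-QFT result; it is
NOT the continuum limit and NOT the Clay problem."*  THIS FILE DISCHARGES NOTHING OF THE KIND.  Elementary real analysis about ABSTRACT functionals on a box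
]0,γ]^ℕ with displayed floors, profiles and signs, and the FIRST-ORDER renewal objects of route (N) built from them — hypotheses of a census, not facts; the
form, signs, ages and moments of Bałaban's (1.22) limit functional are NOT PRINTED ([I] p. 298; GAPS G-t4-U2-1∕-2) and NOT asserted.  Row D4 class
UNCHANGED (critical-path width 0; instance 0∕1; D4 DISCHARGE NO DATE).  HONEST DEPENDENCY: continuum YM on T⁴ ⇐ BetaPertH ∧ nine spine estimates (0/9
proved); BetaPertH ⇐ (D1) ∧ (D4) ∧ CAP+tail; G-an2-4 gates asym, D1 and NE2/3/4.

THE POINT (census sense (α); route (N); README `HOME/b2b-balaban-beta-d4-p2/g75/e84/README.md`).  (E84a) reduced the static decay family (S-d) along a two-age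
flow to the damping-free product inequality (★) `c_{m+1}·d_{m+1+k}·Π_p Hup_p ≤ c_m·d_{m+1}·(Π_t(1+F_t))⁻¹·(1+F_{m+2})⁻¹·(1 − d_{m+2}Hup_{m+2})`.  In the levels
`a = 1∕h²` the two coefficient ratios are products of cubed step ratios (`c_{m+1}∕c_m = (h_{m+k+1}∕h_{m+k})³`, `d_{m+1+k}∕d_{m+1} = Π_{p∈[m+2,m+2+k)}(h_{p+1}∕h_p)³`,
§2 `prod_ratio_cube`), and every factor of (★) lies below the exponential of an elementary term: with the level step `y_p = 1 − (h_{p+1}∕h_p)² = 1 − a_p∕a_{p+1}`,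
**`(h_{p+1}∕h_p)³ ≤ exp(−(3∕2)(y_p + y_p²∕2))`** (§1 `cube_le_exp`: the logarithmic series `−log(1−y) = Σ_n y^n∕n` truncated after the quadratic term), `1 + F ≤ e^F`,
`Hup_p = (1 + ϑ_pω_p)∕(1 − c_p) ≤ exp(ϑ_pω_p + c_p∕(1−c_p))` (`growth_le_exp`), `e^{−u∕(1−u)} ≤ 1 − u`.  Hence §3 **`product_of_linear_budget`**: (★) FOLLOWS from the LINEARISED BUDGET
**`(3∕2)(y_{m+k} + y_{m+k}²∕2) + Σ_{p∈[m+2,m+2+k)} (3∕2)(y_p + y_p²∕2) ≥ Σ_{t∈[m+1,m+k+1)} F_t + F_{m+2} + Σ_p (ϑ_p·x_p∕(1−x_p) + c_p∕(1−c_p)) + d_{m+2}Hup_{m+2}∕(1 − d_{m+2}Hup_{m+2})`**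
(credits: the old age's decay step and the young age's `k` decay steps across the window; debits: the old row's window dampings at the floor, the young
entry's one damping, the growth majorants' defect and lag-zero parts, the last factor), and §4 **`flow_product_of_linear_budget`** ∕
**`flow_nonneg_two_ages_of_linear_budget`**: along the flow (`x_p = kc_p ≤ 3∕4` by (E82b) `load_le_of_window`, `ϑ_p = 1 − (h_{p+k+1}∕h_{p+k})³∕(1+F_{p+k+1}) ≥ 0`)
the two-age END of (E84a) with (★) replaced by this budget at every pin.  WHY THE QUADRATIC TERM (numerics of record `g75/numerics/p5.py`, `p6.py`, `p9b.py`;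
kit j330934): with the linear credit `(3∕2)y` alone the budget still holds (min `+0.14·S`) but its YOUNG part — the young decay steps against the young loads in
the window dampings and the last factor — is thin for a saturated old age over an infinitesimal young one (`+0.07·Σd` at `k = 6`); the quadratic term's cross
part `6c_{p+1}d_{p+1}ρ_pρ¹_p` (from `y_p ≥ 2d_{p+1}ρ¹_p + 2c_{p+1}ρ_p`, domination) restores a margin `≥ 0.85·Σd` for every `k ≤ 24` tested, which is what
makes per-pin lemmas with crude constants possible for the successor ((E84c)).  NOT CLAIMED: the budget along flows; anything printed.

WHAT IS PROVED ([folklore]; 0 `def`, 0 sorry).  §1 **`cube_le_exp`**, `inv_one_sub_le_exp`, `growth_le_exp`;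
§2 `prod_ratio_cube`; §3 **`product_of_linear_budget`**; §4 **`flow_product_of_linear_budget`**, **`flow_nonneg_two_ages_of_linear_budget`**.
-/
noncomputable section
open Finset

namespace Summit.QuantumFields.BalabanUV.Beta.EriceRemainderEnclosureHistoryAutonomyComparisonAgeCompositionDecayBudget

open Literature.MathematicalPhysics.QuantumFieldTheory.Balaban1983to89
open Literature.MathematicalPhysics.QuantumFieldTheory.Balaban1983to89.T4BetaStationary
open Literature.MathematicalPhysics.QuantumFieldTheory.Balaban1983to89.T4BetaFlowWellPosed
open Summit.QuantumFields.BalabanUV.Beta.EriceRemainderEnclosureHistoryAutonomyOrder (strictAnti_of_memFlow)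
open Summit.QuantumFields.BalabanUV.Beta.EriceRemainderEnclosureHistoryAutonomyComparisonAgeCompositionYoungestTailSumFlow (load_le_of_window)
open Summit.QuantumFields.BalabanUV.Beta.EriceRemainderEnclosureHistoryAutonomyComparisonAgeCompositionDecayReduction (flow_nonneg_two_ages_of_product)

variable {B : (ℕ → ℝ) → ℝ} {γ b gIR : ℝ} {L : ℕ → ℝ} {K : ℕ} {h g : ℕ → ℝ} {KL θ : ℕ → ℕ → ℕ → ℝ}

/-! ## §1 Scalar exponential bounds -/

/-- **THE STEP CREDIT.**  For a ratio `0 < t ≤ 1` with `y = 1 − t²`: `t³ ≤ exp(−(3∕2)(y + y²∕2))` — the logarithmic series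
`−log(1−y) = Σ_n y^n∕n` (Mathlib `Real.hasSum_pow_div_log_of_abs_lt_one`) truncated after the quadratic term (the same two-term bound as the tree's
`Summit.QuantumAdvantage.…SelectionChernoffExchange.log_series_lower`, inlined), and `3 log t = (3∕2) log(1−y)`. [folklore] -/
theorem cube_le_exp {t : ℝ} (ht0 : 0 < t) (ht1 : t ≤ 1) : t ^ 3 ≤ Real.exp (-(3 / 2 * ((1 - t ^ 2) + (1 - t ^ 2) ^ 2 / 2))) := by
  have hy0 : 0 ≤ 1 - t ^ 2 := by nlinarith
  have hy1 : 1 - t ^ 2 < 1 := by nlinarith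
  have h2 : (1 - t ^ 2) + (1 - t ^ 2) ^ 2 / 2 ≤ -(2 * Real.log t) := by
    have hs := Real.hasSum_pow_div_log_of_abs_lt_one (show |1 - t ^ 2| < 1 by rw [abs_of_nonneg hy0]; exact hy1)
    have hs2 := sum_le_hasSum (range 2) (fun i _ => by positivity) hs
    norm_num [sum_range_succ] at hs2
    exact hs2
  have e3 : t ^ 3 = Real.exp (3 * Real.log t) := by
    rw [show (3:ℝ) * Real.log t = ((3:ℕ):ℝ) * Real.log t by push_cast; ring, ← Real.log_pow, Real.exp_log (by positivity)]
  rw [e3, Real.exp_le_exp]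
  linarith

/-- `1∕(1−c) ≤ exp(c∕(1−c))` for `c < 1` (`1∕(1−c) = 1 + c∕(1−c)`). [folklore] -/
theorem inv_one_sub_le_exp {c : ℝ} (hc : c < 1) : 1 / (1 - c) ≤ Real.exp (c / (1 - c)) := by
  have h0 : (1:ℝ) - c ≠ 0 := by linarith
  have : 1 / (1 - c) = c / (1 - c) + 1 := by field_simp; ring
  rw [this]; exact Real.add_one_le_exp _

/-- **THE GROWTH-FACTOR DEBIT.**  `(1 + ϑ·ω)∕(1 − c) ≤ exp(ϑ·ω + c∕(1−c))` for `ϑ·ω ≥ 0`, `c < 1`. [folklore] -/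
theorem growth_le_exp (a : ℝ) {c : ℝ} (hc : c < 1) : (1 + a) / (1 - c) ≤ Real.exp (a + c / (1 - c)) := by
  rw [Real.exp_add, div_eq_mul_one_div]
  have h0 : 0 < 1 - c := by linarith
  exact mul_le_mul (by linarith [Real.add_one_le_exp a]) (inv_one_sub_le_exp hc) (by positivity) (Real.exp_pos _).le

/-! ## §2 The young decay telescopes over the window -/

/-- `Π_{p∈[a,a+n)} (h_{p+1}∕h_p)³ = (h_{a+n}∕h_a)³` for a positive sequence. [folklore] -/
theorem prod_ratio_cube {h : ℕ → ℝ} (hpos : ∀ n, 0 < h n) (a n : ℕ) :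
    ∏ p ∈ Ico a (a + n), (h (p + 1) / h p) ^ 3 = (h (a + n) / h a) ^ 3 := by
  induction n with
  | zero => simp [div_self (hpos a).ne']
  | succ n ih =>
    rw [show a + (n + 1) = a + n + 1 by ring, prod_Ico_succ_top (by omega), ih, ← mul_pow]
    congr 1
    have := hpos (a + n); have := hpos a
    field_simp

/-! ## §3 The product inequality from the linearised budget -/

/-- **THE DAMPING-FREE PRODUCT INEQUALITY FROM THE LINEARISED LOGARITHMIC BUDGET.**  Positive non-increasing `h`; non-negative loads `F`; at the pins
`p ∈ [m+2, m+2+k)` coefficients `0 ≤ c_p < 1`, masses `0 ≤ x_p < 1`, defects `ϑ_p ≥ 0` and the growth majorants `Hup_p = (1 + ϑ_p·x_p∕(1−x_p))∕(1−c_p)`;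
a young coefficient `d ≥ 0` with `d·Hup_{m+2} < 1`.  IF, with the level steps `y_p = 1 − (h_{p+1}∕h_p)²`,
`(3∕2)(y_{m+k} + y_{m+k}²∕2) + Σ_{p∈[m+2,m+2+k)} (3∕2)(y_p + y_p²∕2) ≥ Σ_{t∈[m+1,m+k+1)} F_t + F_{m+2} + Σ_{p∈[m+2,m+2+k)} (ϑ_p·x_p∕(1−x_p) + c_p∕(1−c_p))
 + d·Hup_{m+2}∕(1 − d·Hup_{m+2})`, THEN
`(h_{m+k+1}∕h_{m+k})³·(h_{m+2+k}∕h_{m+2})³·Π_p Hup_p·Π_t (1+F_t)·(1+F_{m+2}) ≤ 1 − d·Hup_{m+2}` — every factor below the exponential of its term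
(`t³ ≤ e^{−(3∕2)(y+y²∕2)}` by the logarithmic series, `1+F ≤ e^F`, `(1+ϑω)∕(1−c) ≤ e^{ϑω + c∕(1−c)}`, `e^{−u∕(1−u)} ≤ 1−u`). [folklore] -/
theorem product_of_linear_budget {h F c x ϑ Hup : ℕ → ℝ} {d : ℝ} {m k : ℕ} (hpos : ∀ n, 0 < h n) (hanti : Antitone h)
    (hF0 : ∀ t, 0 ≤ F t) (hc1 : ∀ p ∈ Ico (m + 2) (m + 2 + k), c p < 1)
    (hx0 : ∀ p, 0 ≤ x p) (hx1 : ∀ p ∈ Ico (m + 2) (m + 2 + k), x p < 1) (hϑ0 : ∀ p ∈ Ico (m + 2) (m + 2 + k), 0 ≤ ϑ p)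
    (hHup : ∀ p, Hup p = (1 + ϑ p * (x p / (1 - x p))) / (1 - c p)) (hdH : d * Hup (m + 2) < 1) (hk : 1 ≤ k)
    (hbudget : ∑ t ∈ Ico (m + 1) (m + k + 1), F t + F (m + 2) + ∑ p ∈ Ico (m + 2) (m + 2 + k), (ϑ p * (x p / (1 - x p)) + c p / (1 - c p))
        + d * Hup (m + 2) / (1 - d * Hup (m + 2)) ≤
      3 / 2 * ((1 - (h (m + k + 1) / h (m + k)) ^ 2) + (1 - (h (m + k + 1) / h (m + k)) ^ 2) ^ 2 / 2)
        + ∑ p ∈ Ico (m + 2) (m + 2 + k), 3 / 2 * ((1 - (h (p + 1) / h p) ^ 2) + (1 - (h (p + 1) / h p) ^ 2) ^ 2 / 2)) :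
    (h (m + k + 1) / h (m + k)) ^ 3 * (h (m + 2 + k) / h (m + 2)) ^ 3 * (∏ p ∈ Ico (m + 2) (m + 2 + k), Hup p)
        * (∏ t ∈ Ico (m + 1) (m + k + 1), (1 + F t)) * (1 + F (m + 2)) ≤ 1 - d * Hup (m + 2) := by
  have hm2 : m + 2 ∈ Ico (m + 2) (m + 2 + k) := by rw [mem_Ico]; omega
  -- ratios in ]0,1]
  have hrat : ∀ n, 0 < h (n + 1) / h n ∧ h (n + 1) / h n ≤ 1 := fun n =>
    ⟨div_pos (hpos _) (hpos _), (div_le_one (hpos n)).mpr (hanti (Nat.le_succ n))⟩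
  -- Hup ≥ 0 and ≤ exp
  have hω0 : ∀ p ∈ Ico (m + 2) (m + 2 + k), 0 ≤ ϑ p * (x p / (1 - x p)) := fun p hp =>
    mul_nonneg (hϑ0 p hp) (div_nonneg (hx0 p) (by linarith [hx1 p hp]))
  have hHup0 : ∀ p ∈ Ico (m + 2) (m + 2 + k), 0 ≤ Hup p := fun p hp => by
    rw [hHup]; exact div_nonneg (by linarith [hω0 p hp]) (by linarith [hc1 p hp])
  have hHupE : ∀ p ∈ Ico (m + 2) (m + 2 + k), Hup p ≤ Real.exp (ϑ p * (x p / (1 - x p)) + c p / (1 - c p)) := fun p hp => by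
    rw [hHup]; exact growth_le_exp _ (hc1 p hp)
  -- the five factors below exponentials
  have f1 : (h (m + k + 1) / h (m + k)) ^ 3 ≤
      Real.exp (-(3 / 2 * ((1 - (h (m + k + 1) / h (m + k)) ^ 2) + (1 - (h (m + k + 1) / h (m + k)) ^ 2) ^ 2 / 2))) :=
    cube_le_exp (hrat (m + k)).1 (hrat (m + k)).2
  have f2 : (h (m + 2 + k) / h (m + 2)) ^ 3 ≤
      Real.exp (-(∑ p ∈ Ico (m + 2) (m + 2 + k), 3 / 2 * ((1 - (h (p + 1) / h p) ^ 2) + (1 - (h (p + 1) / h p) ^ 2) ^ 2 / 2))) := by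
    rw [← prod_ratio_cube hpos (m + 2) k, ← sum_neg_distrib, Real.exp_sum]
    exact prod_le_prod (fun p _ => pow_nonneg (hrat p).1.le 3) fun p _ => cube_le_exp (hrat p).1 (hrat p).2
  have f3 : ∏ p ∈ Ico (m + 2) (m + 2 + k), Hup p ≤ Real.exp (∑ p ∈ Ico (m + 2) (m + 2 + k), (ϑ p * (x p / (1 - x p)) + c p / (1 - c p))) := by
    rw [Real.exp_sum]; exact prod_le_prod hHup0 hHupE
  have f4 : ∏ t ∈ Ico (m + 1) (m + k + 1), (1 + F t) ≤ Real.exp (∑ t ∈ Ico (m + 1) (m + k + 1), F t) := by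
    rw [Real.exp_sum]
    exact prod_le_prod (fun t _ => by linarith [hF0 t]) fun t _ => by linarith [Real.add_one_le_exp (F t)]
  have f5 : 1 + F (m + 2) ≤ Real.exp (F (m + 2)) := by linarith [Real.add_one_le_exp (F (m + 2))]
  -- multiply
  have hP3 : 0 ≤ ∏ p ∈ Ico (m + 2) (m + 2 + k), Hup p := prod_nonneg hHup0
  have hP4 : 0 ≤ ∏ t ∈ Ico (m + 1) (m + k + 1), (1 + F t) := prod_nonneg fun t _ => by linarith [hF0 t]
  have hq0 : 0 ≤ (h (m + 2 + k) / h (m + 2)) ^ 3 := pow_nonneg (div_pos (hpos _) (hpos _)).le 3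
  have step := mul_le_mul (mul_le_mul (mul_le_mul (mul_le_mul f1 f2 hq0 (Real.exp_pos _).le)
    f3 hP3 (by positivity)) f4 hP4 (by positivity)) f5 (by linarith [hF0 (m + 2)]) (by positivity)
  refine step.trans ?_
  rw [← Real.exp_add, ← Real.exp_add, ← Real.exp_add, ← Real.exp_add]
  -- the last factor: `e^{−u∕(1−u)} ≤ 1 − u` (as the tree's `Literature.NumberTheory.Sieve.exp_neg_div_le_one_sub`, inlined)
  have hlast : Real.exp (-(d * Hup (m + 2) / (1 - d * Hup (m + 2)))) ≤ 1 - d * Hup (m + 2) := by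
    have h0 : 0 < 1 - d * Hup (m + 2) := by linarith
    rw [Real.exp_neg, inv_le_comm₀ (Real.exp_pos _) h0, inv_eq_one_div]
    exact inv_one_sub_le_exp hdH
  refine le_trans ?_ hlast
  rw [Real.exp_le_exp]
  linarith


/-! ## §4 Along the flow -/

/-- **(★) AT A PIN ALONG THE FLOW FROM THE LINEARISED BUDGET.**  Two-age profile `{1, k}` (`2 ≤ k < K`), `h` a box solution of an isotone memory with floor
dominated by `L ≥ 0`; `c_n = L_kh_{n+k}³∕2`, `d_n = L_1h_{n+1}³∕2`, `F_t = Σ_j L_jh_{t+j}³∕2`, `Hup_p` the flow majorant of (E84a) (`x_p = kc_p`,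
`ϑ_p = 1 − (h_{p+k+1}∕h_{p+k})³∕(1+F_{p+k+1})`), `d_{m+2}Hup_{m+2} < 1`.  IF the linearised budget of §3 holds at the pin `m` THEN (★) holds there
(`x_p ≤ 3∕4` for `p ≥ 1` by (E82b) `load_le_of_window`; `ϑ_p ≥ 0`; `c_{m+1} = c_m·(h_{m+k+1}∕h_{m+k})³`, `d_{m+1+k} = d_{m+1}·(h_{m+2+k}∕h_{m+2})³`). [folklore] -/
theorem flow_product_of_linear_budget (hmono : ∀ u v : ℕ → ℝ, SeqBox γ u → SeqBox γ v → (∀ j, u j ≤ v j) → B u ≤ B v)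
    (hL : ∀ k, 0 ≤ L k) (hb : 0 < b) (hlo : ∀ u, SeqBox γ u → b ≤ B u) (hdom : ∀ u, SeqBox γ u → ∑ k ∈ range K, L k * u k ≤ B u)
    (hh : SeqBox γ h) (hf : MemFlow B gIR h) {k : ℕ} (hk2 : 2 ≤ k) (hkK : k < K)
    {c d F Hup : ℕ → ℝ} (hc : ∀ n, c n = L k * h (n + k) ^ 3 / 2) (hd : ∀ n, d n = L 1 * h (n + 1) ^ 3 / 2)
    (hF : ∀ t, F t = ∑ j ∈ range K, L j * h (t + j) ^ 3 / 2)
    (hHup : ∀ p, Hup p = (1 + (1 - (h (p + k + 1) / h (p + k)) ^ 3 / (1 + F (p + k + 1))) * ((k * c p) / (1 - k * c p))) / (1 - c p))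
    {m : ℕ} (hdH : d (m + 2) * Hup (m + 2) < 1)
    (hbudget : ∑ t ∈ Ico (m + 1) (m + k + 1), F t + F (m + 2)
        + ∑ p ∈ Ico (m + 2) (m + 2 + k), ((1 - (h (p + k + 1) / h (p + k)) ^ 3 / (1 + F (p + k + 1))) * ((k * c p) / (1 - k * c p)) + c p / (1 - c p))
        + d (m + 2) * Hup (m + 2) / (1 - d (m + 2) * Hup (m + 2)) ≤
      3 / 2 * ((1 - (h (m + k + 1) / h (m + k)) ^ 2) + (1 - (h (m + k + 1) / h (m + k)) ^ 2) ^ 2 / 2)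
        + ∑ p ∈ Ico (m + 2) (m + 2 + k), 3 / 2 * ((1 - (h (p + 1) / h p) ^ 2) + (1 - (h (p + 1) / h p) ^ 2) ^ 2 / 2)) :
    c (m + 1) * d (m + 1 + k) * ∏ p ∈ Ico (m + 2) (m + 2 + k), Hup p ≤
      c m * d (m + 1) * (∏ t ∈ Ico (m + 1) (m + k + 1), (1 + F t))⁻¹ * (1 + F (m + 2))⁻¹ * (1 - d (m + 2) * Hup (m + 2)) := by
  have hpos : ∀ n, 0 < h n := fun n => (hh n).1
  have hanti := (strictAnti_of_memFlow hb hlo hh hf).antitone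
  have hF0 : ∀ t, 0 ≤ F t := fun t => by
    rw [hF]; exact sum_nonneg fun j _ => by have := hL j; have := hpos (t + j); positivity
  have hc0 : ∀ n, 0 ≤ c n := fun n => by rw [hc]; have := hL k; have := hpos (n + k); positivity
  have hd0 : ∀ n, 0 ≤ d n := fun n => by rw [hd]; have := hL 1; have := hpos (n + 1); positivity
  -- the window mass below 3/4 at the pins p ≥ 1
  have hx1 : ∀ p ∈ Ico (m + 2) (m + 2 + k), (k : ℝ) * c p < 1 := fun p hp => by
    have hp1 : 1 ≤ p := by rw [mem_Ico] at hp; omega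
    have h1 := load_le_of_window hmono hL hb hlo hdom hh hf hp1 hkK
    have h2 : 0 ≤ (h (p + k) / h p) ^ 2 := sq_nonneg _
    rw [hc]; linarith
  have hkr : (1 : ℝ) ≤ k := by exact_mod_cast (show 1 ≤ k by omega)
  have hc1 : ∀ p ∈ Ico (m + 2) (m + 2 + k), c p < 1 := fun p hp => by
    have := hx1 p hp; have := hc0 p; nlinarith
  have hϑ0 : ∀ p ∈ Ico (m + 2) (m + 2 + k), 0 ≤ 1 - (h (p + k + 1) / h (p + k)) ^ 3 / (1 + F (p + k + 1)) := fun p _ => by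
    have hs0 : 0 ≤ h (p + k + 1) / h (p + k) := div_nonneg (hpos _).le (hpos _).le
    have hs1 : h (p + k + 1) / h (p + k) ≤ 1 := (div_le_one (hpos _)).mpr (hanti (by omega))
    have h3 : (h (p + k + 1) / h (p + k)) ^ 3 ≤ 1 := pow_le_one₀ hs0 hs1
    have h4 : (h (p + k + 1) / h (p + k)) ^ 3 / (1 + F (p + k + 1)) ≤ (h (p + k + 1) / h (p + k)) ^ 3 :=
      div_le_self (pow_nonneg hs0 3) (by linarith [hF0 (p + k + 1)])
    linarith
  have H := product_of_linear_budget (ϑ := fun p => 1 - (h (p + k + 1) / h (p + k)) ^ 3 / (1 + F (p + k + 1))) (x := fun p => (k : ℝ) * c p)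
    hpos hanti hF0 hc1 (fun p => mul_nonneg (by linarith) (hc0 p)) hx1 hϑ0 (fun p => hHup p) hdH (by omega) hbudget
  -- the coefficient ratios are the cubed step ratios
  have ec : c (m + 1) = c m * (h (m + k + 1) / h (m + k)) ^ 3 := by
    rw [hc, hc, show m + 1 + k = m + k + 1 by ring, div_pow]
    have := hpos (m + k); field_simp
  have ed : d (m + 1 + k) = d (m + 1) * (h (m + 2 + k) / h (m + 2)) ^ 3 := by
    rw [hd, hd, show m + 1 + k + 1 = m + 2 + k by ring, show m + 1 + 1 = m + 2 by ring, div_pow]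
    have := hpos (m + 2); field_simp
  have hP : 0 < ∏ t ∈ Ico (m + 1) (m + k + 1), (1 + F t) := prod_pos fun t _ => by linarith [hF0 t]
  have hQ : 0 < 1 + F (m + 2) := by linarith [hF0 (m + 2)]
  set X := (h (m + k + 1) / h (m + k)) ^ 3 * (h (m + 2 + k) / h (m + 2)) ^ 3 * ∏ p ∈ Ico (m + 2) (m + 2 + k), Hup p with hX
  have hX' : X ≤ (∏ t ∈ Ico (m + 1) (m + k + 1), (1 + F t))⁻¹ * (1 + F (m + 2))⁻¹ * (1 - d (m + 2) * Hup (m + 2)) := by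
    have e : (∏ t ∈ Ico (m + 1) (m + k + 1), (1 + F t))⁻¹ * (1 + F (m + 2))⁻¹ * (1 - d (m + 2) * Hup (m + 2)) =
        (1 - d (m + 2) * Hup (m + 2)) / ((∏ t ∈ Ico (m + 1) (m + k + 1), (1 + F t)) * (1 + F (m + 2))) := by
      field_simp
    rw [e, le_div_iff₀ (mul_pos hP hQ)]
    calc X * ((∏ t ∈ Ico (m + 1) (m + k + 1), (1 + F t)) * (1 + F (m + 2)))
        = X * (∏ t ∈ Ico (m + 1) (m + k + 1), (1 + F t)) * (1 + F (m + 2)) := by ring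
      _ ≤ 1 - d (m + 2) * Hup (m + 2) := H
  calc c (m + 1) * d (m + 1 + k) * ∏ p ∈ Ico (m + 2) (m + 2 + k), Hup p = c m * d (m + 1) * X := by rw [ec, ed, hX]; ring
    _ ≤ c m * d (m + 1) * ((∏ t ∈ Ico (m + 1) (m + k + 1), (1 + F t))⁻¹ * (1 + F (m + 2))⁻¹ * (1 - d (m + 2) * Hup (m + 2))) :=
        mul_le_mul_of_nonneg_left hX' (mul_nonneg (hc0 m) (hd0 (m + 1)))
    _ = c m * d (m + 1) * (∏ t ∈ Ico (m + 1) (m + k + 1), (1 + F t))⁻¹ * (1 + F (m + 2))⁻¹ * (1 - d (m + 2) * Hup (m + 2)) := by ring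

/-- **ROUTE (N), FIRST ORDER, END FOR TWO-AGE FLOWS — ON THE LINEARISED LOGARITHMIC BUDGET, EVERY DAMPING IN THE RELAXED CLASS.**  As (E84a)
`flow_nonneg_two_ages_of_product` (two-age profile `{1, k}`, `2 ≤ k`, horizon `K = k + 1`; `h` a box solution; `g` any damping with `1∕(1+F_t) ≤ g_t ≤ 1`;
the first-order objects of route (N) as in (E81k)), with (★) REPLACED by: at every pin `m`, `d_{m+2}Hup_{m+2} < 1` and the linearised budget
`Σ_{t∈[m+1,m+k+1)} F_t + F_{m+2} + Σ_{p∈[m+2,m+2+k)} (ϑ_p·kc_p∕(1−kc_p) + c_p∕(1−c_p)) + d_{m+2}Hup_{m+2}∕(1 − d_{m+2}Hup_{m+2})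
 ≤ (3∕2)(y_{m+k} + y_{m+k}²∕2) + Σ_{p∈[m+2,m+2+k)} (3∕2)(y_p + y_p²∕2)`, `y_p = 1 − (h_{p+1}∕h_p)²` — one additive inequality between the level steps and the
loads per pin.  CONCLUSION: the comparison surplus `ε` of every admissible excess `e` is non-negative. [folklore] -/
theorem flow_nonneg_two_ages_of_linear_budget (hmono : ∀ u v : ℕ → ℝ, SeqBox γ u → SeqBox γ v → (∀ j, u j ≤ v j) → B u ≤ B v)
    (hL : ∀ k, 0 ≤ L k) (hb : 0 < b) (hlo : ∀ u, SeqBox γ u → b ≤ B u) (hdom : ∀ u, SeqBox γ u → ∑ k ∈ range K, L k * u k ≤ B u)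
    (hh : SeqBox γ h) (hf : MemFlow B gIR h)
    (hg : ∀ t, 0 < g t ∧ g t ≤ 1) (hgF : ∀ t, 1 / (1 + ∑ k ∈ range K, L k * h (t + k) ^ 3 / 2) ≤ g t)
    {k : ℕ} (hk2 : 2 ≤ k) (hKk : K = k + 1) (hL2 : ∀ j, j < K → j ≠ 1 → j ≠ k → L j = 0)
    (hKL : ∀ k n l, KL k n l = if 0 < k ∧ k < K ∧ l < k then L k * h (n + k) ^ 3 / 2 * ∏ t ∈ Ico (n + 1 + l) (n + k + 1), g t else 0)
    (hθ : ∀ k n l, θ k n l = 1 - (h (n + k + l) / h (n + k)) ^ 3 * ∏ t ∈ Ico (n + k + 1) (n + k + l + 1), g t)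
    {KA : ℕ → ℕ → ℕ → ℝ} {RL RA SL SA : ℕ → (ℕ → ℝ) → ℕ → ℝ}
    (hRL : ∀ i v m, RL i v m = ∑ l ∈ range K, KL i m l * v (m + 1 + l))
    (hRA : ∀ i v m, RA i v m = ∑ l ∈ range K, KA i m l * v (m + 1 + l))
    (hKA : ∀ i m l, KA i m l = KL i m l + KA (i + 1) m l) (hKAtop : ∀ m l, KA K m l = 0)
    (hSL : ∀ i (w : ℕ → ℝ), (∀ m, K < m → w m = 0) → (∀ m, K < m → SL i w m = 0) ∧ ∀ m, SL i w m = w m - RL i (SL i w) m)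
    (hSA : ∀ i (w : ℕ → ℝ), (∀ m, K < m → w m = 0) → (∀ m, K < m → SA i w m = 0) ∧ ∀ m, SA i w m = w m - RA i (SA i w) m)
    {ρ : ℕ → ℕ → ℝ} {β : ℕ → ℕ → ℕ → ℝ}
    (hρ : ∀ i n, 1 ≤ i → i ≤ K - 1 → ρ i n = (∑ l ∈ range K, KL i n l) * (1 + ∑ k ∈ Ioc i (K - 1), θ k n i * β (i + 1) n k) /
      (1 - ∑ k ∈ Ioc i (K - 1), ∑ l ∈ range i, KL k n l))
    (hβnew : ∀ i n, 1 ≤ i → i ≤ K - 1 → β i n i = ρ i n / (1 - ρ i n))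
    (hβold : ∀ i n k, 1 ≤ i → i < k → k ≤ K - 1 → β i n k = β (i + 1) n k / (1 - ρ i n))
    {Hg : ℕ → ℕ → ℝ} (hH : ∀ i m, Hg i m = (1 + ∑ k ∈ Ioc i (K - 1), θ k m 1 * β (i + 1) m k) / (1 - ∑ k ∈ Ioc i (K - 1), KL k m 0))
    {c d F Hup : ℕ → ℝ} (hc : ∀ n, c n = L k * h (n + k) ^ 3 / 2) (hd : ∀ n, d n = L 1 * h (n + 1) ^ 3 / 2)
    (hF : ∀ t, F t = ∑ j ∈ range K, L j * h (t + j) ^ 3 / 2)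
    (hHup : ∀ p, Hup p = (1 + (1 - (h (p + k + 1) / h (p + k)) ^ 3 / (1 + F (p + k + 1))) * ((k * c p) / (1 - k * c p))) / (1 - c p))
    (hdH : ∀ m, d (m + 2) * Hup (m + 2) < 1)
    (hbudget : ∀ m, ∑ t ∈ Ico (m + 1) (m + k + 1), F t + F (m + 2)
        + ∑ p ∈ Ico (m + 2) (m + 2 + k), ((1 - (h (p + k + 1) / h (p + k)) ^ 3 / (1 + F (p + k + 1))) * ((k * c p) / (1 - k * c p)) + c p / (1 - c p))
        + d (m + 2) * Hup (m + 2) / (1 - d (m + 2) * Hup (m + 2)) ≤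
      3 / 2 * ((1 - (h (m + k + 1) / h (m + k)) ^ 2) + (1 - (h (m + k + 1) / h (m + k)) ^ 2) ^ 2 / 2)
        + ∑ p ∈ Ico (m + 2) (m + 2 + k), 3 / 2 * ((1 - (h (p + 1) / h p) ^ 2) + (1 - (h (p + 1) / h p) ^ 2) ^ 2 / 2))
    {M : ℕ → ℕ → ℝ} (hM : ∀ i m, M i m = KL i m 0 + ∑ l ∈ range (K - 1), max (KL i m (l + 1) - KL i (m + 1) l) 0)
    {HgS : ℕ → ℕ → ℕ → ℝ} (hHS : ∀ i j m, HgS i j m = (1 + ∑ k ∈ Ioc i (K - 1), θ k m 1 * β (i + 1) m k) /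
      (1 - ∑ k ∈ Ioc i (K - 1), (KL k m 0 - if m + 1 + k ≤ j then KL k (m + 1) (k - 1) else 0)))
    {e ε : ℕ → ℝ} (he0 : ∀ m, 0 ≤ e m) (hea : ∀ m, e (m + 1) ≤ e m) (het : ∀ m, K < m → e m = 0)
    (hεt : ∀ m, K < m → ε m = 0) (hεrec : ∀ m, ε m = e m - RA 1 ε m) : ∀ m, 0 ≤ ε m :=
  flow_nonneg_two_ages_of_product hmono hL hb hlo hdom hh hf hg hgF hk2 hKk hL2 hKL hθ hRL hRA hKA hKAtop hSL hSA hρ hβnew hβold hH hc hd hF hHup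
    (fun m => (hdH m).le) (fun m => flow_product_of_linear_budget hmono hL hb hlo hdom hh hf hk2 (by omega) hc hd hF hHup (hdH m) (hbudget m))
    hM hHS he0 hea het hεt hεrec

end Summit.QuantumFields.BalabanUV.Beta.EriceRemainderEnclosureHistoryAutonomyComparisonAgeCompositionDecayBudget

end
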